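import Summits.ValiantsHypothesis.ValiantsHypothesis.Theorems.KPlusLogSqLawOctaveConditioning
import Summits.ValiantsHypothesis.ValiantsHypothesis.Theorems.KPlusLogSqLawTropicalBSmallFormats

/-!
# K1 `OctaveStability` (stmt-ValiantsHypothesis-19561, line «conditioning») — the additive census budget is load-bearing

Negative-lane findings of unit `val-neg-3` on the law stub K1 = `…Theorems.KPlusLogSqLaw.Octave.OctaveStability`
(`Theorems/KPlusLogSqLawOctaveConditioning.lean`; stub `stub_octaveStability` of `Cruxes/WeakLifting/Lines/conditioning.lean` v4):

* `fragileOctave_two_two` — the **fragile octave** at format `(m, K) = (2, 2)`: exponents `d = (0, 1)`, symmetric letters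
  `S₀ = diag(-1, 1)`, `S₁ = diag(1, -1)`, so `pencilDet d S = det [[X - 1, 0], [0, 1 - X]] = -(X - 1)²` has the nonzero real
  root `1` (one octave, `Ω = 1`); the SYMMETRIC perturbation `S₀ ↦ [[-1, ε], [ε, 1]]` (entrywise distance `|ε|`, entry scale
  `ρ = 1` certified by the entry `-1`) gives `pencilDet d S' = -(X - 1)² - ε²`, which for `ε ≠ 0` is a nonzero polynomial with
  NO real root (`Ω = 0`).  Every `ε ≠ 0` works, so no precision `2^{-P}` protects the octave.
* `octaveStability_false_without_budget'` — hence K1 with its additive term `2^{C(K+⌊log₂m⌋²)}(n+1)` DELETED is false for EVERY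
  multiplicative constant `A` (K1 has `A = 3`) and EVERY precision exponent `P(m, K, n)` (K1 has `P = 2^{C(K+⌊log₂m⌋²)}(n+1)`):
  the witness lives at `(m, K, n) = (2, 2, 2)`, where the TropRow hypothesis `TropRootLawAt 2 2 2` is the tree's
  `tropRootLawAt_poly 2 2`; `octaveStability_false_without_budget` is the literal instance (K1 verbatim minus the budget term).
* `octaveCreation_false_without_budget` — the reverse comparison (octaves of the perturbed pencil bounded by those of the
  original) fails the same way with the roles swapped: perturbation CREATES an octave (`Ω : 0 ↦ 1`) at every precision.

Reading for the line.  The kernel already has `octaveStability_iff_octaveWeakLifting : OctaveStability ↔ OctaveWeakLifting`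
(K1 ≡ Ω-W, stmt-24457's door; the direction Ω-W → K1 is `S'`-blind).  This file adds the converse bookkeeping: the
conditioning shape carries NO information beyond the census budget — with the budget removed nothing of the multiplicative
shape `Ω(det S) ≤ A·Ω(det S')` survives, at any precision, already in the smallest nontrivial format and inside every certified
TropRow.  So «conditioning» can only be a PROOF STRATEGY for Ω-W, never a replacement of its budget, and an unconditional
`¬ OctaveStability` is exactly an octave Conjecture-B monster (a TropRow-certified format whose pencils have more than
`2^{C(K+⌊log₂m⌋²)}(n+1)` root octaves for every `C`) — not exhibited here; K1 itself is NOT refuted (at the witness K1 only asks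
`1 ≤ 2^{3C}·3 + 0`).  No summit statement is proved or refuted by this file; VP ≠ VNP is not touched.

Mathlib + the two tree modules above; theorems only (the witness matrices are written out, no `def`, no notation); no facts. [folklore; explicit witness]
-/

set_option linter.dupNamespace false -- single-conjunct summit: the namespace `ValiantsHypothesis.ValiantsHypothesis` repeats a component (D-0017)
set_option autoImplicit false

namespace Summit.ValiantsHypothesis.ValiantsHypothesis.Theorems.WeakLifting.Negative

open Polynomial Finset Matrix
open scoped BigOperators
open Summit.ValiantsHypothesis.ValiantsHypothesis.Theorems.LacunarySymmetroidMatrixDescartes.TropicalCensus (TropRootLawAt tropRootLawAt_poly)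
open Summit.ValiantsHypothesis.ValiantsHypothesis.Theorems.KPlusLogSqLaw.Octave (octave octaveCount pencilDet OctaveStability)

/-! ## The witness polynomial `-((X - 1)² + ε²)` -/

/-- point values of the witness determinant: `-((x - 1)² + ε²)` (so `≤ 0`, and `< 0` everywhere once `ε ≠ 0`). [folklore] -/
theorem eval_witness (ε x : ℝ) : (-((X - C 1) ^ 2 + C (ε ^ 2)) : ℝ[X]).eval x = -((x - 1) ^ 2 + ε ^ 2) := by
  simp

/-- the witness determinant is a NONZERO polynomial (all `ε`; at `ε = 0` it is `-(X-1)²`). [folklore] -/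
theorem witness_ne_zero (ε : ℝ) : (-((X - C 1) ^ 2 + C (ε ^ 2)) : ℝ[X]) ≠ 0 := by
  intro h
  have h2 := eval_witness ε 2
  rw [h, eval_zero] at h2
  nlinarith [sq_nonneg ε]

/-- unperturbed: `Ω(-(X - 1)²) = 1` — the double root `1` occupies octave `0`. [folklore] -/
theorem octaveCount_witness_zero : octaveCount (-((X - C (1 : ℝ)) ^ 2 + C ((0 : ℝ) ^ 2))) = 1 := by
  have h : -((X - C (1 : ℝ)) ^ 2 + C ((0 : ℝ) ^ 2)) = -((X - C 1) ^ 2) := by simp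
  rw [h]
  unfold octaveCount
  rw [roots_neg, roots_pow, roots_X_sub_C]
  simp [Finset.filter_singleton]

/-- perturbed, `ε ≠ 0`: `Ω(-(X - 1)² - ε²) = 0` — no real roots at all. [folklore] -/
theorem octaveCount_witness_ne {ε : ℝ} (hε : ε ≠ 0) : octaveCount (-((X - C 1) ^ 2 + C (ε ^ 2))) = 0 := by
  unfold octaveCount
  have hroots : (-((X - C 1) ^ 2 + C (ε ^ 2)) : ℝ[X]).roots = 0 := by
    refine Multiset.eq_zero_of_forall_notMem fun x hx => ?_
    rw [mem_roots (witness_ne_zero ε), IsRoot.def, eval_witness] at hx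
    have : 0 < ε ^ 2 := by positivity
    nlinarith [sq_nonneg (x - 1)]
  rw [hroots]
  simp

/-! ## The witness pencil at format `(2, 2)`: `d = (0, 1)`, `S₀(ε) = [[-1, ε], [ε, 1]]`, `S₁ = diag(1, -1)` -/

/-- the witness pencil determinant: `det [[X - 1, ε], [ε, 1 - X]] = -((X - 1)² + ε²)`. [folklore] -/
theorem pencilDet_witness (ε : ℝ) :
    pencilDet (![0, 1] : Fin 2 → ℕ) (![!![-1, ε; ε, 1], !![1, 0; 0, -1]] : Fin 2 → Matrix (Fin 2) (Fin 2) ℝ) =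
      -((X - C 1) ^ 2 + C (ε ^ 2)) := by
  unfold pencilDet
  rw [Matrix.det_fin_two]
  simp [Matrix.sum_apply, Fin.sum_univ_two, map_pow]
  ring

/-- the witness letters are symmetric. [folklore] -/
theorem witness_isSymm (ε : ℝ) : ∀ l, ((![!![-1, ε; ε, 1], !![1, 0; 0, -1]] : Fin 2 → Matrix (Fin 2) (Fin 2) ℝ) l).IsSymm := by
  intro l
  fin_cases l <;> (refine Matrix.IsSymm.ext ?_; intro i j; fin_cases i <;> fin_cases j <;> simp)

/-- **The fragile octave at format `(2, 2)`.**  For every `ε ≠ 0` there are injective exponents `d` and symmetric `(2, 2)` letters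
`S`, `S'` with: entry scale `1` certified for `S` and for `S'` (all moduli `≤ 1`, resp. `≤ max 1 |ε|`, the entry `-1` of modulus `1`),
`S'` entrywise within `|ε|` of `S`, both pencil determinants nonzero, and `Ω(pencilDet d S) = 1` but `Ω(pencilDet d S') = 0`.
Witness: `d = (0, 1)`, `S = (diag(-1, 1), diag(1, -1))`, `S' = ([[-1, ε], [ε, 1]], diag(1, -1))`. [folklore; explicit witness] -/
theorem fragileOctave_two_two {ε : ℝ} (hε : ε ≠ 0) :
    ∃ (d : Fin 2 → ℕ) (S S' : Fin 2 → Matrix (Fin 2) (Fin 2) ℝ), Function.Injective d ∧ (∀ l, (S l).IsSymm) ∧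
      (∀ l, (S' l).IsSymm) ∧ (∀ l, (∀ i j, |S l i j| ≤ 1) ∧ ∃ i j, (1 : ℝ) ≤ |S l i j|) ∧ (∀ l i j, |S' l i j - S l i j| ≤ |ε|) ∧
      (∀ l, (∀ i j, |S' l i j| ≤ max 1 |ε|) ∧ ∃ i j, (1 : ℝ) ≤ |S' l i j|) ∧ pencilDet d S ≠ 0 ∧ pencilDet d S' ≠ 0 ∧
      octaveCount (pencilDet d S) = 1 ∧ octaveCount (pencilDet d S') = 0 := by
  refine ⟨![0, 1], ![!![-1, 0; 0, 1], !![1, 0; 0, -1]], ![!![-1, ε; ε, 1], !![1, 0; 0, -1]], ?_, witness_isSymm 0,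
    witness_isSymm ε, ?_, ?_, ?_, ?_, ?_, ?_, ?_⟩
  · intro i j h
    fin_cases i <;> fin_cases j <;> simp_all
  · intro l
    fin_cases l
    · exact ⟨fun i j => by fin_cases i <;> fin_cases j <;> simp, 0, 0, by simp⟩
    · exact ⟨fun i j => by fin_cases i <;> fin_cases j <;> simp, 0, 0, by simp⟩
  · intro l i j
    fin_cases l <;> fin_cases i <;> fin_cases j <;> simp
  · intro l
    fin_cases l
    · exact ⟨fun i j => by fin_cases i <;> fin_cases j <;> simp, 0, 0, by simp⟩
    · exact ⟨fun i j => by fin_cases i <;> fin_cases j <;> simp, 0, 0, by simp⟩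
  · rw [pencilDet_witness]; exact witness_ne_zero 0
  · rw [pencilDet_witness]; exact witness_ne_zero ε
  · rw [pencilDet_witness]; exact octaveCount_witness_zero
  · rw [pencilDet_witness]; exact octaveCount_witness_ne hε

/-! ## Consequences for the conditioning shape of K1 -/

/-- **K1 without its additive budget is false — for every multiplicative constant and every precision.**  No statement of the
shape «TropRow at `(m, K, n)` ⇒ for symmetric `S`, `S'` with injective exponents, entry scales `ρ`, `2^{P(m,K,n)}·|S' − S| ≤ ρ`
entrywise and `pencilDet d S' ≠ 0`: `Ω(pencilDet d S) ≤ A · Ω(pencilDet d S')`» holds: the fragile octave at `(2, 2, 2)`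
(`tropRootLawAt_poly 2 2`, `ε = 2^{-P(2,2,2)}`) gives `1 ≤ A · 0`. [folklore; explicit witness] -/
theorem octaveStability_false_without_budget' (P : ℕ → ℕ → ℕ → ℕ) (A : ℕ) :
    ¬ (∀ (m K n : ℕ), TropRootLawAt m K n →
        ∀ (d : Fin K → ℕ) (S S' : Fin K → Matrix (Fin m) (Fin m) ℝ) (ρ : Fin K → ℝ), Function.Injective d →
          (∀ l, (S l).IsSymm) → (∀ l, (S' l).IsSymm) → (∀ l, 0 < ρ l) → (∀ l, (∀ i j, |S l i j| ≤ ρ l) ∧ ∃ i j, ρ l ≤ |S l i j|) →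
          (∀ l i j, (2 : ℝ) ^ (P m K n) * |S' l i j - S l i j| ≤ ρ l) →
          pencilDet d S' ≠ 0 →
          octaveCount (pencilDet d S) ≤ A * octaveCount (pencilDet d S')) := by
  intro h
  have hrow : TropRootLawAt 2 2 ((2 + 1) ^ (2 - 1) - 1) := tropRootLawAt_poly 2 2
  set p : ℕ := P 2 2 ((2 + 1) ^ (2 - 1) - 1) with hp
  have h2 : (0 : ℝ) < (2 : ℝ) ^ p := by positivity
  have hε : ((2 : ℝ) ^ p)⁻¹ ≠ 0 := (inv_pos.2 h2).ne'
  obtain ⟨d, S, S', hd, hS, hS', hsc, hdist, -, -, hne, hΩ, hΩ'⟩ := fragileOctave_two_two hε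
  have key := h 2 2 _ hrow d S S' (fun _ => 1) hd hS hS' (fun _ => one_pos) hsc ?_ hne
  · rw [hΩ, hΩ'] at key
    omega
  · intro l i j
    have := hdist l i j
    rw [abs_inv, abs_of_pos h2] at this
    calc (2 : ℝ) ^ p * |S' l i j - S l i j| ≤ (2 : ℝ) ^ p * ((2 : ℝ) ^ p)⁻¹ := by gcongr
      _ = 1 := mul_inv_cancel₀ h2.ne'

/-- **K1 verbatim with the additive term `2^{C(K+⌊log₂m⌋²)}(n+1)` deleted is false** (instance `A = 3`,
`P = 2^{C(K+⌊log₂m⌋²)}(n+1)` of `octaveStability_false_without_budget'`, for every `C`): the census budget of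
`OctaveStability` is load-bearing; the multiplicative conditioning term alone bounds nothing. [folklore; explicit witness] -/
theorem octaveStability_false_without_budget :
    ¬ ∃ C : ℕ, ∀ (m K n : ℕ), TropRootLawAt m K n →
        ∀ (d : Fin K → ℕ) (S S' : Fin K → Matrix (Fin m) (Fin m) ℝ) (ρ : Fin K → ℝ), Function.Injective d →
          (∀ l, (S l).IsSymm) → (∀ l, (S' l).IsSymm) → (∀ l, 0 < ρ l) → (∀ l, (∀ i j, |S l i j| ≤ ρ l) ∧ ∃ i j, ρ l ≤ |S l i j|) →
          (∀ l i j, (2 : ℝ) ^ (2 ^ (C * (K + Nat.log 2 m ^ 2)) * (n + 1)) * |S' l i j - S l i j| ≤ ρ l) →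
          pencilDet d S' ≠ 0 →
          octaveCount (pencilDet d S) ≤ 3 * octaveCount (pencilDet d S') :=
  fun ⟨C, h⟩ => octaveStability_false_without_budget' (fun m K n => 2 ^ (C * (K + Nat.log 2 m ^ 2)) * (n + 1)) 3 h

/-- **The reverse comparison also needs a budget**: «`Ω(pencilDet d S') ≤ A · Ω(pencilDet d S)`» under the same hypotheses is
false for every `A` and every precision — perturbation CREATES an octave (`S = ` the rootless pencil, `S'` = the one with the
double root `1`, distance `2^{-P}`). [folklore; explicit witness] -/
theorem octaveCreation_false_without_budget (P : ℕ → ℕ → ℕ → ℕ) (A : ℕ) :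
    ¬ (∀ (m K n : ℕ), TropRootLawAt m K n →
        ∀ (d : Fin K → ℕ) (S S' : Fin K → Matrix (Fin m) (Fin m) ℝ) (ρ : Fin K → ℝ), Function.Injective d →
          (∀ l, (S l).IsSymm) → (∀ l, (S' l).IsSymm) → (∀ l, 0 < ρ l) → (∀ l, (∀ i j, |S l i j| ≤ ρ l) ∧ ∃ i j, ρ l ≤ |S l i j|) →
          (∀ l i j, (2 : ℝ) ^ (P m K n) * |S' l i j - S l i j| ≤ ρ l) →
          pencilDet d S' ≠ 0 →
          octaveCount (pencilDet d S') ≤ A * octaveCount (pencilDet d S)) := by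
  intro h
  have hrow : TropRootLawAt 2 2 ((2 + 1) ^ (2 - 1) - 1) := tropRootLawAt_poly 2 2
  set p : ℕ := P 2 2 ((2 + 1) ^ (2 - 1) - 1) with hp
  have h2 : (0 : ℝ) < (2 : ℝ) ^ p := by positivity
  have h21 : (1 : ℝ) ≤ (2 : ℝ) ^ p := one_le_pow₀ (by norm_num)
  have hε : ((2 : ℝ) ^ p)⁻¹ ≠ 0 := (inv_pos.2 h2).ne'
  have hε1 : |((2 : ℝ) ^ p)⁻¹| ≤ 1 := by rw [abs_inv, abs_of_pos h2]; exact inv_le_one_of_one_le₀ h21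
  obtain ⟨d, S, S', hd, hS, hS', -, hdist, hsc', hne, -, hΩ, hΩ'⟩ := fragileOctave_two_two hε
  have key := h 2 2 _ hrow d S' S (fun _ => 1) hd hS' hS (fun _ => one_pos) ?_ ?_ hne
  · rw [hΩ, hΩ'] at key
    omega
  · intro l
    obtain ⟨hle, i, j, hij⟩ := hsc' l
    exact ⟨fun i j => (hle i j).trans (max_le le_rfl hε1), i, j, hij⟩
  · intro l i j
    have := hdist l i j
    rw [abs_inv, abs_of_pos h2] at this
    rw [abs_sub_comm]
    calc (2 : ℝ) ^ p * |S' l i j - S l i j| ≤ (2 : ℝ) ^ p * ((2 : ℝ) ^ p)⁻¹ := by gcongr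
      _ = 1 := mul_inv_cancel₀ h2.ne'

end Summit.ValiantsHypothesis.ValiantsHypothesis.Theorems.WeakLifting.Negative
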